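import Summits.HodgeConjecture.CorCM.IrreducibleOddWeightsRightIdealsCharacters
import Summits.HodgeConjecture.CorCM.IrreducibleOddWeightsRightIdealsPivotFamiliesCMFields
import HarnessLib

/-!
# Right ideals, VI b: ABELIAN pivots — `Σ_i dim Hg(A_i) − dim Hg(∏_i A_i) = Σ_i #S_i − #⋃_i S_i`, the excess multiplicity
# of the characters of `Gal(M/ℚ)` seen by the shadows; pairs: `dim Hg(A₀) + dim Hg(A₁) − dim Hg(A₀ × A₁) = #(S₀ ∩ S₁)`

COR-CM (cell `pub-hodgecm2`, binder seat `b16` gen 64, count-neutral claim RIGHT IDEALS, file R6b — CM-field dress of R6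
`IrreducibleOddWeightsRightIdealsCharacters` on top of R4/R5b; theorems only, no definition, no named fact, no `sorry`).
NEW as stated, hence under `Summits/`.  HONEST FRAMING: the tree's multiplicity formula for CM fields INSIDE one abelian
field (`Literature/…/AbelianCMFamilyRankCharacters.cmFamilyRank_add_card_add_sum_eq`: the defect is the excess
multiplicity of the odd characters seen by the members) is proved here for ARBITRARY CM fields SHARING an abelian subfield
`M` (the pivot), the characters being those of `Gal(M/ℚ)` seen by the SHADOWS, under the gluing hypothesis (GL) of R5b;
`HC_CM` is neither used nor asserted.

SETTING (R4, R5b).  CM fields `K_i`, CM types `Φ_i`, `A_i ⊨ (K_i; Φ_i)`; `M` ABELIAN Galois over `ℚ`, `j_i : M → K_i`,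
`z₀ : M → ℂ`; the shadow read on `Γ = Gal(M/ℚ)`: `W_i(γ) = Σ_{t | t∘j_i = z₀∘γ} u_1(Φ_i)(t) = 2·#{t ∈ Φ_i : t|_M = z₀∘γ} − [K_i:M]`;
`S_i = {χ ∈ Γ̂ : Σ_γ W_i(γ)χ(γ) ≠ 0}` — the characters of the pivot SEEN by the shadow of `Φ_i`.  (GL): every Galois closure
`L_l` meets the compositum of the other closures inside `z₀(M)`.

* §1 `finrank_span_precomp_shadow_eq_ncard`, `finrank_iSup_span_precomp_shadow_eq_ncard` — transport `Γ ≃ Hom(M, ℂ)`,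
  `γ ↦ z₀ ∘ γ`: the Hecke module `H_i = span{w_i(· ∘ δ)}` has dimension `#S_i`, and `dim Σ_i H_i = #⋃_i S_i` (R6).
* §2 **`sum_cmTypeRank_add_one_add_ncard_eq`** — under (GL): `Σ_i cmTypeRank Φ_i + 1 + #⋃_i S_i = cmFamilyRank Φ + |I| +
  Σ_i #S_i`, i.e. **`Σ_i dim Hg(A_i) − dim Hg(∏_i A_i) = Σ_i #S_i − #⋃_i S_i = Σ_χ (n_χ − 1)⁺`**, `n_χ = #{i : χ ∈ S_i}`;
  **`cmTypeRank_add_cmTypeRank_eq_cmFamilyRank_add_one_add_ncard_inter`** — two fields (closures meeting inside `z₀(M)`):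
  **`dim Hg(A₀) + dim Hg(A₁) − dim Hg(A₀ × A₁) = #(S₀ ∩ S₁)`**, the number of characters of the pivot seen by BOTH shadows
  (gen 63's correlation criterion `…ShadowIdealsCMFields` is the case `S₀ ∩ S₁ = ∅`).

## References

* [Kubota1965] T. Kubota, *On the field extension by complex multiplication*, Trans. AMS 118 (1965), §2 Lemma 1–2, §4.
* [Gordon1999HodgeAVSurvey] B. B. Gordon, *A survey of the Hodge conjecture for abelian varieties*, Prop. 9.4.1, §3,
  7.5–7.7.
* [Deligne1982HodgeCycles] P. Deligne, *Hodge cycles on abelian varieties*, LNM 900 (1982), I.5 (p. 53), I Ex. 3.7 (c).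
* [Shimura1998] G. Shimura, *Abelian Varieties with Complex Multiplication and Modular Functions*, §8.1, §8.3.
-/

set_option autoImplicit false

noncomputable section

open scoped BigOperators Classical

open CategoryTheory CategoryTheory.Limits NumberField Module IntermediateField

namespace Summit.HodgeConjecture.CorCM

open Literature.NumberTheory.ComplexMultiplication
open Literature.AlgebraicGeometry.Motives (AbelianVariety CMType)
open Literature.AlgebraicGeometry.Pohlmann1968

/-! ### §1 Transport `Gal(M/ℚ) ≃ Hom(M, ℂ)` and the character count of the Hecke modules -/

section Transport

variable {K : Type} [Field K] [NumberField K] {M : Type} [Field M] [NumberField M] [Normal ℚ M]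

omit [Normal ℚ M] in
/-- The Hecke translates `w(· ∘ δ)` of a shadow, pulled back along `γ ↦ z₀ ∘ γ`, are the translates `γ ↦ W(γδ)` of
`W(γ) = w(z₀ ∘ γ)` on the group. [cite: Shimura1998, §8.1] -/
theorem map_funLeft_span_precomp_shadow_eq (Φ : CMType K) (jM : M →+* K) (z₀ : M →+* ℂ) :
    (Submodule.span ℚ (Set.range fun δ : M ≃ₐ[ℚ] M => fun z : M →+* ℂ =>
        ∑ t ∈ Finset.univ.filter (fun t : K →+* ℂ => t.comp jM = z.comp (δ : M →+* M)),
          antiVec Φ.1 (1 : ℂ ≃+* ℂ) t)).map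
        (LinearMap.funLeft ℚ ℚ fun γ : M ≃ₐ[ℚ] M => z₀.comp (γ : M →+* M)) =
      Submodule.span ℚ (Set.range fun δ : M ≃ₐ[ℚ] M => fun γ : M ≃ₐ[ℚ] M =>
        ∑ t ∈ Finset.univ.filter (fun t : K →+* ℂ => t.comp jM = z₀.comp ((γ * δ : M ≃ₐ[ℚ] M) : M →+* M)),
          antiVec Φ.1 (1 : ℂ ≃+* ℂ) t) := by
  have key : ∀ (δ γ : M ≃ₐ[ℚ] M), (z₀.comp (γ : M →+* M)).comp (δ : M →+* M) =
      z₀.comp ((γ * δ : M ≃ₐ[ℚ] M) : M →+* M) := fun δ γ => RingHom.ext fun m => by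
    simp only [RingHom.comp_apply, RingHom.coe_coe, AlgEquiv.mul_apply]
  rw [Submodule.map_span, ← Set.range_comp]
  refine congrArg _ (Set.ext fun c => ⟨?_, ?_⟩)
  · rintro ⟨δ, rfl⟩
    exact ⟨δ, funext fun γ => by simp only [Function.comp_apply, LinearMap.funLeft_apply, key]⟩
  · rintro ⟨δ, rfl⟩
    exact ⟨δ, funext fun γ => by simp only [Function.comp_apply, LinearMap.funLeft_apply, key]⟩

/-- The pull-back along `γ ↦ z₀ ∘ γ` is injective (`M` normal: every embedding is `z₀ ∘ γ`). [cite: Shimura1998, §8.1] -/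
theorem funLeft_comp_algEquiv_injective (z₀ : M →+* ℂ) :
    Function.Injective (LinearMap.funLeft ℚ ℚ fun γ : M ≃ₐ[ℚ] M => z₀.comp (γ : M →+* M)) :=
  LinearMap.funLeft_injective_of_surjective _ _ _ fun z => exists_comp_algEquiv_eq z z₀

open scoped IsMulCommutative in
/-- **`dim H = #S`**: for `M` ABELIAN, the Hecke module of a shadow has dimension the number of characters of `Gal(M/ℚ)`
seen by it. [cite: Kubota1965, §2 Lemma 1 and §4 Lemma 2] -/
theorem finrank_span_precomp_shadow_eq_ncard [IsAbelianGalois ℚ M] (Φ : CMType K) (jM : M →+* K) (z₀ : M →+* ℂ) :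
    Module.finrank ℚ (Submodule.span ℚ (Set.range fun δ : M ≃ₐ[ℚ] M => fun z : M →+* ℂ =>
        ∑ t ∈ Finset.univ.filter (fun t : K →+* ℂ => t.comp jM = z.comp (δ : M →+* M)),
          antiVec Φ.1 (1 : ℂ ≃+* ℂ) t)) =
      {χ : AddChar (Additive (M ≃ₐ[ℚ] M)) ℂ | ∑ γ : M ≃ₐ[ℚ] M,
        ((∑ t ∈ Finset.univ.filter (fun t : K →+* ℂ => t.comp jM = z₀.comp (γ : M →+* M)),
          antiVec Φ.1 (1 : ℂ ≃+* ℂ) t : ℚ) : ℂ) * χ (Additive.ofMul γ) ≠ 0}.ncard := by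
  have h1 := LinearEquiv.finrank_eq (Submodule.equivMapOfInjective _ (funLeft_comp_algEquiv_injective (M := M) z₀)
    (Submodule.span ℚ (Set.range fun δ : M ≃ₐ[ℚ] M => fun z : M →+* ℂ =>
      ∑ t ∈ Finset.univ.filter (fun t : K →+* ℂ => t.comp jM = z.comp (δ : M →+* M)), antiVec Φ.1 (1 : ℂ ≃+* ℂ) t)))
  rw [map_funLeft_span_precomp_shadow_eq Φ jM z₀] at h1
  rw [h1]
  exact IrrOdd.finrank_span_translates_eq_ncard_single (H := M ≃ₐ[ℚ] M)
    (fun γ : M ≃ₐ[ℚ] M => ∑ t ∈ Finset.univ.filter (fun t : K →+* ℂ => t.comp jM = z₀.comp (γ : M →+* M)),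
      antiVec Φ.1 (1 : ℂ ≃+* ℂ) t)

variable {I : Type} {K' : I → Type} [∀ i, Field (K' i)] [∀ i, NumberField (K' i)]

open scoped IsMulCommutative in
/-- **`dim Σ_i H_i = #⋃_i S_i`** for the Hecke modules of a family of shadows over an ABELIAN pivot.
[cite: Kubota1965, §4 Lemma 2 (proof)] -/
theorem finrank_iSup_span_precomp_shadow_eq_ncard [IsAbelianGalois ℚ M] [Fintype I] (Φ : ∀ i, CMType (K' i))
    (j : ∀ i, M →+* K' i) (z₀ : M →+* ℂ) :
    Module.finrank ℚ (⨆ i, Submodule.span ℚ (Set.range fun δ : M ≃ₐ[ℚ] M => fun z : M →+* ℂ =>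
        ∑ t ∈ Finset.univ.filter (fun t : K' i →+* ℂ => t.comp (j i) = z.comp (δ : M →+* M)),
          antiVec (Φ i).1 (1 : ℂ ≃+* ℂ) t) : Submodule ℚ ((M →+* ℂ) → ℚ)) =
      {χ : AddChar (Additive (M ≃ₐ[ℚ] M)) ℂ | ∃ i, ∑ γ : M ≃ₐ[ℚ] M,
        ((∑ t ∈ Finset.univ.filter (fun t : K' i →+* ℂ => t.comp (j i) = z₀.comp (γ : M →+* M)),
          antiVec (Φ i).1 (1 : ℂ ≃+* ℂ) t : ℚ) : ℂ) * χ (Additive.ofMul γ) ≠ 0}.ncard := by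
  have h1 := LinearEquiv.finrank_eq (Submodule.equivMapOfInjective _ (funLeft_comp_algEquiv_injective (M := M) z₀)
    (⨆ i, Submodule.span ℚ (Set.range fun δ : M ≃ₐ[ℚ] M => fun z : M →+* ℂ =>
      ∑ t ∈ Finset.univ.filter (fun t : K' i →+* ℂ => t.comp (j i) = z.comp (δ : M →+* M)),
        antiVec (Φ i).1 (1 : ℂ ≃+* ℂ) t)))
  rw [Submodule.map_iSup, iSup_congr fun i => map_funLeft_span_precomp_shadow_eq (Φ i) (j i) z₀] at h1
  rw [h1]
  exact IrrOdd.finrank_iSup_span_translates_eq_ncard (H := M ≃ₐ[ℚ] M)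
    (fun i (γ : M ≃ₐ[ℚ] M) => ∑ t ∈ Finset.univ.filter (fun t : K' i →+* ℂ => t.comp (j i) = z₀.comp (γ : M →+* M)),
      antiVec (Φ i).1 (1 : ℂ ≃+* ℂ) t)

open scoped IsMulCommutative in
/-- **`dim(H₀ ∩ H₁) = #(S₀ ∩ S₁)`** over an ABELIAN pivot. [cite: Kubota1965, §4 Lemma 2] -/
theorem finrank_inf_span_precomp_shadow_eq_ncard_inter [IsAbelianGalois ℚ M] {i₀ i₁ : I} (Φ : ∀ i, CMType (K' i))
    (j₀ : M →+* K' i₀) (j₁ : M →+* K' i₁) (z₀ : M →+* ℂ) :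
    Module.finrank ℚ (Submodule.span ℚ (Set.range fun δ : M ≃ₐ[ℚ] M => fun z : M →+* ℂ =>
          ∑ t ∈ Finset.univ.filter (fun t : K' i₀ →+* ℂ => t.comp j₀ = z.comp (δ : M →+* M)),
            antiVec (Φ i₀).1 (1 : ℂ ≃+* ℂ) t) ⊓
        Submodule.span ℚ (Set.range fun δ : M ≃ₐ[ℚ] M => fun z : M →+* ℂ =>
          ∑ t ∈ Finset.univ.filter (fun t : K' i₁ →+* ℂ => t.comp j₁ = z.comp (δ : M →+* M)),
            antiVec (Φ i₁).1 (1 : ℂ ≃+* ℂ) t) : Submodule ℚ ((M →+* ℂ) → ℚ)) =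
      ({χ : AddChar (Additive (M ≃ₐ[ℚ] M)) ℂ | ∑ γ : M ≃ₐ[ℚ] M,
          ((∑ t ∈ Finset.univ.filter (fun t : K' i₀ →+* ℂ => t.comp j₀ = z₀.comp (γ : M →+* M)),
            antiVec (Φ i₀).1 (1 : ℂ ≃+* ℂ) t : ℚ) : ℂ) * χ (Additive.ofMul γ) ≠ 0} ∩
        {χ : AddChar (Additive (M ≃ₐ[ℚ] M)) ℂ | ∑ γ : M ≃ₐ[ℚ] M,
          ((∑ t ∈ Finset.univ.filter (fun t : K' i₁ →+* ℂ => t.comp j₁ = z₀.comp (γ : M →+* M)),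
            antiVec (Φ i₁).1 (1 : ℂ ≃+* ℂ) t : ℚ) : ℂ) * χ (Additive.ofMul γ) ≠ 0}).ncard := by
  have hinj := funLeft_comp_algEquiv_injective (M := M) z₀
  have h1 := LinearEquiv.finrank_eq (Submodule.equivMapOfInjective _ hinj
    (Submodule.span ℚ (Set.range fun δ : M ≃ₐ[ℚ] M => fun z : M →+* ℂ =>
          ∑ t ∈ Finset.univ.filter (fun t : K' i₀ →+* ℂ => t.comp j₀ = z.comp (δ : M →+* M)),
            antiVec (Φ i₀).1 (1 : ℂ ≃+* ℂ) t) ⊓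
        Submodule.span ℚ (Set.range fun δ : M ≃ₐ[ℚ] M => fun z : M →+* ℂ =>
          ∑ t ∈ Finset.univ.filter (fun t : K' i₁ →+* ℂ => t.comp j₁ = z.comp (δ : M →+* M)),
            antiVec (Φ i₁).1 (1 : ℂ ≃+* ℂ) t)))
  rw [Submodule.map_inf _ hinj, map_funLeft_span_precomp_shadow_eq (Φ i₀) j₀ z₀,
    map_funLeft_span_precomp_shadow_eq (Φ i₁) j₁ z₀] at h1
  rw [h1]
  exact IrrOdd.finrank_inf_span_translates_eq_ncard_inter (H := M ≃ₐ[ℚ] M)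
    (fun γ : M ≃ₐ[ℚ] M => ∑ t ∈ Finset.univ.filter (fun t : K' i₀ →+* ℂ => t.comp j₀ = z₀.comp (γ : M →+* M)),
      antiVec (Φ i₀).1 (1 : ℂ ≃+* ℂ) t)
    (fun γ : M ≃ₐ[ℚ] M => ∑ t ∈ Finset.univ.filter (fun t : K' i₁ →+* ℂ => t.comp j₁ = z₀.comp (γ : M →+* M)),
      antiVec (Φ i₁).1 (1 : ℂ ≃+* ℂ) t)

end Transport

/-! ### §2 The defect as an excess multiplicity of characters of the pivot -/

section Rank

variable {I : Type} [Fintype I] {K : I → Type} [∀ i, Field (K i)] [∀ i, NumberField (K i)] [∀ i, IsCMField (K i)]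
  {M : Type} [Field M] [NumberField M]

open scoped IsMulCommutative in
/-- **THE DEFECT OVER AN ABELIAN PIVOT IS AN EXCESS MULTIPLICITY OF CHARACTERS.**  CM fields `K_i`, CM types `Φ_i`,
`M` abelian over `ℚ` with `j_i : M → K_i`, `z₀ : M → ℂ`, hypothesis (GL).  With `S_i` the set of characters `χ` of
`Gal(M/ℚ)` SEEN by the shadow of `Φ_i` (`Σ_γ W_i(γ)χ(γ) ≠ 0`, `W_i(γ) = 2·#{t ∈ Φ_i : t|_M = z₀∘γ} − [K_i:M]`):
`Σ_i cmTypeRank Φ_i + 1 + #⋃_i S_i = cmFamilyRank Φ + |I| + Σ_i #S_i`, i.e.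
**`Σ_i dim Hg(A_i) − dim Hg(∏_i A_i) = Σ_i #S_i − #⋃_i S_i = Σ_χ (n_χ − 1)⁺`**.
[cite: Kubota1965, §4 Lemma 2] [cite: Gordon1999HodgeAVSurvey, Prop. 9.4.1 and 7.5–7.7] -/
theorem sum_cmTypeRank_add_one_add_ncard_eq [IsAbelianGalois ℚ M] [Nonempty I] (Φ : ∀ i, CMType (K i))
    (j : ∀ i, M →+* K i) (z₀ : M →+* ℂ)
    (hmeet : ∀ (l : I) (z : ℂ), z ∈ normalClosure ℚ (K l) ℂ →
      z ∈ (⨆ i : {i : I // i ≠ l}, normalClosure ℚ (K i.1) ℂ) → z ∈ Set.range z₀) :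
    (∑ i, cmTypeRank (Φ i)) + 1 +
        {χ : AddChar (Additive (M ≃ₐ[ℚ] M)) ℂ | ∃ i, ∑ γ : M ≃ₐ[ℚ] M,
          ((∑ t ∈ Finset.univ.filter (fun t : K i →+* ℂ => t.comp (j i) = z₀.comp (γ : M →+* M)),
            antiVec (Φ i).1 (1 : ℂ ≃+* ℂ) t : ℚ) : ℂ) * χ (Additive.ofMul γ) ≠ 0}.ncard =
      CMAlgebra.cmFamilyRank Φ + Fintype.card I +
        ∑ i, {χ : AddChar (Additive (M ≃ₐ[ℚ] M)) ℂ | ∑ γ : M ≃ₐ[ℚ] M,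
          ((∑ t ∈ Finset.univ.filter (fun t : K i →+* ℂ => t.comp (j i) = z₀.comp (γ : M →+* M)),
            antiVec (Φ i).1 (1 : ℂ ≃+* ℂ) t : ℚ) : ℂ) * χ (Additive.ofMul γ) ≠ 0}.ncard := by
  rw [← finrank_iSup_span_precomp_shadow_eq_ncard Φ j z₀,
    ← Finset.sum_congr rfl fun i _ => finrank_span_precomp_shadow_eq_ncard (Φ i) (j i) z₀]
  exact sum_cmTypeRank_add_one_add_finrank_iSup_eq Φ j z₀ hmeet

open scoped IsMulCommutative in
/-- **TWO CM FIELDS OVER A COMMON ABELIAN PIVOT: `dim Hg(A₀) + dim Hg(A₁) − dim Hg(A₀ × A₁) = #(S₀ ∩ S₁)`** — the number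
of characters of `Gal(M/ℚ)` seen by BOTH shadows (`I = {i₀, i₁}`, Galois closures meeting inside `z₀(M)`); gen 63's
correlation criterion is the case `S₀ ∩ S₁ = ∅`. [cite: Kubota1965, §2 Lemma 2 and §4] [cite: Gordon1999HodgeAVSurvey, Prop. 9.4.1 and 7.5–7.7] -/
theorem cmTypeRank_add_cmTypeRank_eq_cmFamilyRank_add_one_add_ncard_inter [IsAbelianGalois ℚ M] {i₀ i₁ : I}
    (h01 : i₀ ≠ i₁) (hI : ∀ l, l = i₀ ∨ l = i₁) (Φ : ∀ i, CMType (K i)) (j₀ : M →+* K i₀) (j₁ : M →+* K i₁)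
    (z₀ : M →+* ℂ)
    (hmeet : ∀ z : ℂ, z ∈ normalClosure ℚ (K i₀) ℂ → z ∈ normalClosure ℚ (K i₁) ℂ → z ∈ Set.range z₀) :
    cmTypeRank (Φ i₀) + cmTypeRank (Φ i₁) = CMAlgebra.cmFamilyRank Φ + 1 +
      ({χ : AddChar (Additive (M ≃ₐ[ℚ] M)) ℂ | ∑ γ : M ≃ₐ[ℚ] M,
          ((∑ t ∈ Finset.univ.filter (fun t : K i₀ →+* ℂ => t.comp j₀ = z₀.comp (γ : M →+* M)),
            antiVec (Φ i₀).1 (1 : ℂ ≃+* ℂ) t : ℚ) : ℂ) * χ (Additive.ofMul γ) ≠ 0} ∩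
        {χ : AddChar (Additive (M ≃ₐ[ℚ] M)) ℂ | ∑ γ : M ≃ₐ[ℚ] M,
          ((∑ t ∈ Finset.univ.filter (fun t : K i₁ →+* ℂ => t.comp j₁ = z₀.comp (γ : M →+* M)),
            antiVec (Φ i₁).1 (1 : ℂ ≃+* ℂ) t : ℚ) : ℂ) * χ (Additive.ofMul γ) ≠ 0}).ncard := by
  rw [← finrank_inf_span_precomp_shadow_eq_ncard_inter Φ j₀ j₁ z₀]
  exact cmTypeRank_add_cmTypeRank_eq_cmFamilyRank_add_one_add_finrank_inf h01 hI Φ j₀ j₁ z₀ hmeet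

end Rank

end Summit.HodgeConjecture.CorCM

end
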